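import Mathlib
import Summits.KontsevichZagierPeriods.Zeta5Search.FamB5Points
import Summits.KontsevichZagierPeriods.Zeta5Search.CellKitCentre
import Summits.KontsevichZagierPeriods.Zeta5Search.ZeroWindowKit
import Summits.KontsevichZagierPeriods.Zeta5Search.FamB5Z6P1
import HarnessLib

/-!
# ζ(5) search — T1-map ray `bRay βB5 n`: zero window `M = 6` (`6 * n < p`, `2 * p < 13 * n`): `T1Rays.FamB5ZeroClassesZ6` (part 2/2)

HONEST FRAMING: systematic search; no irrationality claim unless certified.

Cell `pub-zeta5`, GEN-2 seat generation 19, with p3 g3's window machine (`code/gen/zwgen.py`; gen-2 g16's fork `t1gen` for general rays `bRay β n`,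
g19 copy `pub-zeta5-gen-2/g19/t1gen` with the ray key `B5`; point facts from the ray point kit `T1Rays.FamB5Points`) in the format of typer g14's `Ray4OriginM8*`: exact scale-free
class analysis of the ray `b(n) = n·(23; 11 10 9 8 7 6 5)` on the window `6 * n < p` and `2 * p < 13 * n`
(all odd `p` and all `n ≤ 150`: 2812 instances; class lengths `3 4`; bracket signatures per length
`3:8 4:9`); every statement then PROVED (`omega` leaf by leaf; one LEAF theorem per signature;
decision tree inline in `zw_L*`).  Target: gen-2 g19's `@[conjecture]` node `T1Rays.FamB5ZeroClassesZ6`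
(`ZeroWindowClasses (bRay βB5 n) p 6 …`: deep palindrome(s) `DzB5` and extra pair member(s) `SzB5`) and hence the window
bound `T1Rays.FamB5WindowZ6` (-6) by gen-2 g19's PROVED reduction `T1Rays.famB5WindowZ6_of` (`FamB5Windows.lean`), i.e. the `t = 5` slice
`FamilyTiers.FamilyCellBAt5` of census g11's `CellAtlas.FamilyCellB` (`T1Rays.familyCellBAt5_of_window`).
Integer bookkeeping (`netExp` along residue classes); valuations of rationals; nothing here bears on irrationality.
-/

open Finset

namespace Summit.KontsevichZagierPeriods.Zeta5Search.FamB5Z6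

open Summit.KontsevichZagierPeriods.Zeta5Search.ClusterValuation (netExp classSet CentreIn classExp conjClass classPoleCount)
open Summit.KontsevichZagierPeriods.Zeta5Search.CasoratianValuation (InPolytope shift casoratian)
open Summit.KontsevichZagierPeriods.Zeta5Search.CellKit
open Summit.KontsevichZagierPeriods.Zeta5Search.SecondOrder (classTypeList isRaise classTypeList_level)
open Summit.KontsevichZagierPeriods.Zeta5Search.ZeroWindows
open Summit.KontsevichZagierPeriods.Zeta5Search.T1Rays
open Summit.KontsevichZagierPeriods.Zeta5Search.T1Rays.FamB5Points

variable {p : ℕ} [hp : Fact p.Prime]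

set_option maxHeartbeats 800000 in
/-- **Zero-window structure of the classes of `3` points** (`M = 6`): exponent `≥ −6`; the `−6` classes are
centre-free of a type in `DzB5`; the `−5` classes are raises / odd-centre satellites of `DzB5` or centre-free members
of the extra pair `SzB5` (directly or through the conjugate class). -/
theorem zw_L2 {n x : ℕ} (h1 : 6 * n < p) (h2 : 2 * p < 13 * n) (hp2 : p % 2 = 1) (hx : x < p)
    (hL : x + 2 * p ≤ 23 * n) (hL' : 23 * n < x + 2 * p + p) :
    (-6 : ℤ) ≤ classExp (bRay βB5 n) p x ∧
    (classExp (bRay βB5 n) p x = -6 → ¬ CentreIn (bRay βB5 n) p x ∧ classTypeList (bRay βB5 n) p x ∈ DzB5) ∧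
    (classExp (bRay βB5 n) p x = -5 →
      (∃ T ∈ DzB5, isRaise T (classTypeList (bRay βB5 n) p x) = true ∨
        (¬ (2 : ℤ) ∣ (bRay βB5 n) 0 ∧ CentreIn (bRay βB5 n) p x ∧ classTypeList (bRay βB5 n) p x = T)) ∨
      (¬ CentreIn (bRay βB5 n) p x ∧ ∃ s ∈ SzB5, classTypeList (bRay βB5 n) p x = s ∨
        classTypeList (bRay βB5 n) p (conjClass (bRay βB5 n) p x) = s)) := by
  have hE' := classExp_L2 (p := p) (n := n) (x := x) hx hL hL'
  have hT := centreTerm_spec (bRay βB5 n) p x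
  generalize hcT : (if ¬ (2 : ℤ) ∣ (bRay βB5 n) 0 ∧ CentreIn (bRay βB5 n) p x then (1 : ℤ) else 0) = cT at hE' hT
  have h0 : (0 : ℤ) ≤ (bRay βB5 n) 0 := by rw [famB5_zero]; positivity
  have hL1 : x + 2 * p ≤ ((bRay βB5 n) 0).toNat := by rw [b0_toNat]; exact hL
  have hL2 : ((bRay βB5 n) 0).toNat < x + 2 * p + p := by rw [b0_toNat]; exact hL'
  have hcen : CentreIn (bRay βB5 n) p x ↔ 2 * x + 2 * p = 23 * n := by
    rw [centreIn_iff_last (bRay βB5 n) (L := 2) hx hL1 hL2 h0, b0_toNat]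
  have hb0 : (bRay βB5 n) 0 = ((23 * n : ℕ) : ℤ) := famB5_zero n
  rw [hcen, hb0] at hT
  have hTL : classTypeList (bRay βB5 n) p x = [netExp (bRay βB5 n) (x), netExp (bRay βB5 n) (x + p), netExp (bRay βB5 n) (x + 2 * p)] := by
    rw [classTypeList_level (bRay βB5 n) hL1 hL2, show List.range (2 + 1) = [0, 1, 2] from rfl]
    simp only [List.map_cons, List.map_nil, zero_mul, add_zero, one_mul]
  have hTLc : classTypeList (bRay βB5 n) p (conjClass (bRay βB5 n) p x) = [netExp (bRay βB5 n) (x + 2 * p), netExp (bRay βB5 n) (x + p),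
      netExp (bRay βB5 n) (x)] := by
    rw [classTypeList_conj (bRay βB5 n) h0 hx hL1 hL2, hTL]
    simp only [List.reverse_cons, List.reverse_nil, List.nil_append, List.cons_append]
  by_cases ht1 : x < 5 * n
  · by_cases ht2 : x + p < 11 * n
    · by_cases ht3 : x + 2 * p ≤ 17 * n
      · obtain ⟨c1, c2, c3, c4, c5, e0, e1, e2⟩ :=
          leaf_L2_2 h1 h2 hp2 hx hL hL' ht1 ht2 ht3
        simp only [e0, e1, e2] at hTL hTLc
        refine ⟨by omega, fun hE => absurd hE (by omega), fun hE => ?_⟩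
        exact Or.inr ⟨fun hc => by have hc' := hcen.1 hc; omega, [1, -5, -1], by decide, Or.inl (by rw [hTL])⟩
      · obtain ⟨c1, c2, c3, c4, c5, e0, e1, e2⟩ :=
          leaf_L2_1 h1 h2 hp2 hx hL hL' ht1 ht2 ht3
        simp only [e0, e1, e2] at hTL hTLc
        exact ⟨by omega, fun hE => absurd hE (by omega), fun hE => absurd hE (by omega)⟩
    · obtain ⟨c1, c2, c3, c4, c5, c6, e0, e1, e2⟩ :=
        leaf_L2_3 h1 h2 hp2 hx hL hL' ht1 ht2
      simp only [e0, e1, e2] at hTL hTLc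
      refine ⟨by omega, fun hE => absurd hE (by omega), fun _hE => ?_⟩
      exact Or.inl ⟨[0, -6, 0], by decide, Or.inl (by rw [hTL]; decide)⟩
  · by_cases ht2 : x + p ≤ 12 * n
    · by_cases ht3 : x + 2 * p ≤ 18 * n
      · by_cases ht4 : 2 * (x + p) = 23 * n
        · obtain ⟨c1, c2, c3, c4, c5, e0, e1, e2⟩ :=
            leaf_L2_7 h1 h2 hp2 hx hL hL' ht1 ht2 ht3 ht4
          simp only [e0, e1, e2] at hTL hTLc
          refine ⟨by omega, fun hE => absurd hE (by omega), fun _hE => ?_⟩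
          exact Or.inl ⟨[0, -6, 0], by decide, Or.inl (by rw [hTL]; decide)⟩
        · obtain ⟨c1, c2, c3, c4, c5, c6, c7, e0, e1, e2⟩ :=
            leaf_L2_6 h1 h2 hp2 hx hL hL' ht1 ht2 ht3 ht4
          simp only [e0, e1, e2] at hTL hTLc
          refine ⟨by omega, fun hE => ⟨fun hc => by have hc' := hcen.1 hc; omega, by rw [hTL]; decide⟩, fun hE => ?_⟩
          exact Or.inl ⟨[0, -6, 0], by decide, Or.inr ⟨by omega, hcen.2 (by omega), by rw [hTL]⟩⟩
      · obtain ⟨c1, c2, c3, c4, c5, c6, e0, e1, e2⟩ :=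
          leaf_L2_5 h1 h2 hp2 hx hL hL' ht1 ht2 ht3
        simp only [e0, e1, e2] at hTL hTLc
        refine ⟨by omega, fun hE => absurd hE (by omega), fun _hE => ?_⟩
        exact Or.inl ⟨[0, -6, 0], by decide, Or.inl (by rw [hTL]; decide)⟩
    · by_cases ht3 : x < 6 * n
      · obtain ⟨c1, c2, c3, c4, c5, e0, e1, e2⟩ :=
          leaf_L2_4 h1 h2 hp2 hx hL hL' ht1 ht2 ht3
        simp only [e0, e1, e2] at hTL hTLc
        exact ⟨by omega, fun hE => absurd hE (by omega), fun hE => absurd hE (by omega)⟩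
      · obtain ⟨c1, c2, c3, c4, c5, e0, e1, e2⟩ :=
          leaf_L2_8 h1 h2 hp2 hx hL hL' ht1 ht2 ht3
        simp only [e0, e1, e2] at hTL hTLc
        refine ⟨by omega, fun hE => absurd hE (by omega), fun hE => ?_⟩
        exact Or.inr ⟨fun hc => by have hc' := hcen.1 hc; omega, [1, -5, -1], by decide, Or.inr (by rw [hTLc])⟩

set_option maxHeartbeats 800000 in
/-- **Zero-window structure of the classes of `4` points** (`M = 6`): exponent `≥ −6`; the `−6` classes are
centre-free of a type in `DzB5`; the `−5` classes are raises / odd-centre satellites of `DzB5` or centre-free members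
of the extra pair `SzB5` (directly or through the conjugate class). -/
theorem zw_L3 {n x : ℕ} (h1 : 6 * n < p) (h2 : 2 * p < 13 * n) (hp2 : p % 2 = 1) (hx : x < p)
    (hL : x + 3 * p ≤ 23 * n) (hL' : 23 * n < x + 3 * p + p) :
    (-6 : ℤ) ≤ classExp (bRay βB5 n) p x ∧
    (classExp (bRay βB5 n) p x = -6 → ¬ CentreIn (bRay βB5 n) p x ∧ classTypeList (bRay βB5 n) p x ∈ DzB5) ∧
    (classExp (bRay βB5 n) p x = -5 →
      (∃ T ∈ DzB5, isRaise T (classTypeList (bRay βB5 n) p x) = true ∨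
        (¬ (2 : ℤ) ∣ (bRay βB5 n) 0 ∧ CentreIn (bRay βB5 n) p x ∧ classTypeList (bRay βB5 n) p x = T)) ∨
      (¬ CentreIn (bRay βB5 n) p x ∧ ∃ s ∈ SzB5, classTypeList (bRay βB5 n) p x = s ∨
        classTypeList (bRay βB5 n) p (conjClass (bRay βB5 n) p x) = s)) := by
  have hE' := classExp_L3 (p := p) (n := n) (x := x) hx hL hL'
  have hT := centreTerm_spec (bRay βB5 n) p x
  generalize hcT : (if ¬ (2 : ℤ) ∣ (bRay βB5 n) 0 ∧ CentreIn (bRay βB5 n) p x then (1 : ℤ) else 0) = cT at hE' hT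
  have h0 : (0 : ℤ) ≤ (bRay βB5 n) 0 := by rw [famB5_zero]; positivity
  have hL1 : x + 3 * p ≤ ((bRay βB5 n) 0).toNat := by rw [b0_toNat]; exact hL
  have hL2 : ((bRay βB5 n) 0).toNat < x + 3 * p + p := by rw [b0_toNat]; exact hL'
  have hcen : CentreIn (bRay βB5 n) p x ↔ 2 * x + 3 * p = 23 * n := by
    rw [centreIn_iff_last (bRay βB5 n) (L := 3) hx hL1 hL2 h0, b0_toNat]
  have hb0 : (bRay βB5 n) 0 = ((23 * n : ℕ) : ℤ) := famB5_zero n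
  rw [hcen, hb0] at hT
  have hTL : classTypeList (bRay βB5 n) p x = [netExp (bRay βB5 n) (x), netExp (bRay βB5 n) (x + p), netExp (bRay βB5 n) (x + 2 * p),
      netExp (bRay βB5 n) (x + 3 * p)] := by
    rw [classTypeList_level (bRay βB5 n) hL1 hL2, show List.range (3 + 1) = [0, 1, 2, 3] from rfl]
    simp only [List.map_cons, List.map_nil, zero_mul, add_zero, one_mul]
  have hTLc : classTypeList (bRay βB5 n) p (conjClass (bRay βB5 n) p x) = [netExp (bRay βB5 n) (x + 3 * p), netExp (bRay βB5 n) (x + 2 * p),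
      netExp (bRay βB5 n) (x + p), netExp (bRay βB5 n) (x)] := by
    rw [classTypeList_conj (bRay βB5 n) h0 hx hL1 hL2, hTL]
    simp only [List.reverse_cons, List.reverse_nil, List.nil_append, List.cons_append]
  by_cases ht1 : x + p < 8 * n
  · by_cases ht2 : x + p < 7 * n
    · by_cases ht3 : x + 2 * p ≤ 13 * n
      · obtain ⟨c1, c2, c3, c4, c5, c6, e0, e1, e2, e3⟩ :=
          leaf_L3_2 h1 h2 hp2 hx hL hL' ht1 ht2 ht3
        simp only [e0, e1, e2, e3] at hTL hTLc
        exact ⟨by omega, fun hE => absurd hE (by omega), fun hE => absurd hE (by omega)⟩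
      · obtain ⟨c1, c2, c3, c4, c5, c6, e0, e1, e2, e3⟩ :=
          leaf_L3_1 h1 h2 hp2 hx hL hL' ht1 ht2 ht3
        simp only [e0, e1, e2, e3] at hTL hTLc
        exact ⟨by omega, fun hE => absurd hE (by omega), fun hE => absurd hE (by omega)⟩
    · by_cases ht3 : x + 2 * p ≤ 14 * n
      · obtain ⟨c1, c2, c3, c4, c5, c6, e0, e1, e2, e3⟩ :=
          leaf_L3_4 h1 h2 hp2 hx hL hL' ht1 ht2 ht3
        simp only [e0, e1, e2, e3] at hTL hTLc
        exact ⟨by omega, fun hE => absurd hE (by omega), fun hE => absurd hE (by omega)⟩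
      · obtain ⟨c1, c2, c3, c4, c5, c6, e0, e1, e2, e3⟩ :=
          leaf_L3_3 h1 h2 hp2 hx hL hL' ht1 ht2 ht3
        simp only [e0, e1, e2, e3] at hTL hTLc
        exact ⟨by omega, fun hE => absurd hE (by omega), fun hE => absurd hE (by omega)⟩
  · by_cases ht2 : x + p < 9 * n
    · by_cases ht3 : x + 2 * p ≤ 15 * n
      · obtain ⟨c1, c2, c3, c4, c5, c6, e0, e1, e2, e3⟩ :=
          leaf_L3_6 h1 h2 hp2 hx hL hL' ht1 ht2 ht3
        simp only [e0, e1, e2, e3] at hTL hTLc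
        exact ⟨by omega, fun hE => absurd hE (by omega), fun hE => absurd hE (by omega)⟩
      · obtain ⟨c1, c2, c3, c4, c5, c6, e0, e1, e2, e3⟩ :=
          leaf_L3_5 h1 h2 hp2 hx hL hL' ht1 ht2 ht3
        simp only [e0, e1, e2, e3] at hTL hTLc
        exact ⟨by omega, fun hE => absurd hE (by omega), fun hE => absurd hE (by omega)⟩
    · by_cases ht3 : x + p < 10 * n
      · by_cases ht4 : x + 2 * p ≤ 16 * n
        · obtain ⟨c1, c2, c3, c4, c5, c6, e0, e1, e2, e3⟩ :=
            leaf_L3_8 h1 h2 hp2 hx hL hL' ht1 ht2 ht3 ht4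
          simp only [e0, e1, e2, e3] at hTL hTLc
          exact ⟨by omega, fun hE => absurd hE (by omega), fun hE => absurd hE (by omega)⟩
        · obtain ⟨c1, c2, c3, c4, c5, c6, e0, e1, e2, e3⟩ :=
            leaf_L3_7 h1 h2 hp2 hx hL hL' ht1 ht2 ht3 ht4
          simp only [e0, e1, e2, e3] at hTL hTLc
          exact ⟨by omega, fun hE => absurd hE (by omega), fun hE => absurd hE (by omega)⟩
      · obtain ⟨c1, c2, c3, c4, c5, c6, e0, e1, e2, e3⟩ :=
          leaf_L3_9 h1 h2 hp2 hx hL hL' ht1 ht2 ht3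
        simp only [e0, e1, e2, e3] at hTL hTLc
        exact ⟨by omega, fun hE => absurd hE (by omega), fun hE => absurd hE (by omega)⟩

/-- **`T1Rays.FamB5ZeroClassesZ6` IS A THEOREM**: the class structure `ZeroWindowClasses (bRay βB5 n) p 6 DzB5 SzB5` of the zero window
`M = 6` (`6 * n < p`, `2 * p < 13 * n`) of the T1-map ray `bRay βB5 n`, for every `n ≥ 2` and every (odd) prime of the window. -/
theorem famB5ZeroClassesZ6_holds : FamB5ZeroClassesZ6 := by
  intro n p hn hprime h1 h2
  haveI : Fact p.Prime := ⟨hprime⟩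
  have hp2 : p % 2 = 1 := Nat.odd_iff.1 (hprime.odd_of_ne_two (by omega))
  unfold ZeroWindowClasses
  refine ⟨fun x hx _ => ?_, fun x hx _ hE => ?_, fun x hx _ hE => ?_⟩
  · rcases Nat.lt_or_ge (23 * n) (x + 3 * p) with hL3 | hL3
    · have h := (zw_L2 h1 h2 hp2 hx (by omega) (by omega)).1
      omega
    · have h := (zw_L3 h1 h2 hp2 hx (by omega) (by omega)).1
      omega
  · rcases Nat.lt_or_ge (23 * n) (x + 3 * p) with hL3 | hL3
    · exact (zw_L2 h1 h2 hp2 hx (by omega) (by omega)).2.1 (by omega)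
    · exact (zw_L3 h1 h2 hp2 hx (by omega) (by omega)).2.1 (by omega)
  · rcases Nat.lt_or_ge (23 * n) (x + 3 * p) with hL3 | hL3
    · exact (zw_L2 h1 h2 hp2 hx (by omega) (by omega)).2.2 (by omega)
    · exact (zw_L3 h1 h2 hp2 hx (by omega) (by omega)).2.2 (by omega)

/-- **`T1Rays.FamB5WindowZ6` IS A THEOREM**: `v_p(Cas₇(b(n))) ≥ -6` at every prime of the zero window `M = 6`
(`6 * n < p`, `2 * p < 13 * n`) of the ray `bRay βB5 n`, `n ≥ 2` — UNCONDITIONAL: gen-2 g19's PROVED reduction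
`T1Rays.famB5WindowZ6_of` (class structure + the ZERO type-space law `typeSpaceLawZero_holds` + the pigeonhole `affDet_eq_zero_of_classes`)
applied to `famB5ZeroClassesZ6_holds`. -/
theorem famB5WindowZ6_holds : FamB5WindowZ6 := famB5WindowZ6_of famB5ZeroClassesZ6_holds

/-- **`FamilyTiers.FamilyCellBAt5` IS A THEOREM** — the `t = 5` slice of census g11's `CellAtlas.FamilyCellB` (`bFam 5 n = bRay βB5 n`,
`T1Rays.familyCellBAt5_of_window`): for `n ≥ 2` and primes `6n < p < 13n/2`, `v_p(Cas₇(bFam 5 n)) ≥ −6`. -/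
theorem familyCellBAt5_holds : FamilyTiers.FamilyCellBAt5 := familyCellBAt5_of_window famB5WindowZ6_holds

end Summit.KontsevichZagierPeriods.Zeta5Search.FamB5Z6
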